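import Summits.FinalStateConjecture.FinalStateConjecture.Theorems.StarvedNecksNeckGapDecayGlueBelt
import Summits.FinalStateConjecture.FinalStateConjecture.Theorems.StarvedNecksNeckGapDecayGlueDeviation
import Literature.Geometry.Lorentzian.BackgroundChartCalculusLocal
import Literature.Uncategorized.BilinPullbackNearIdConst
import HarnessLib

/-!
# P-glue: the gap certificate from the core certificate (crux `StarvedNecks.NeckGapDecay`,
# stmt-FinalStateConjecture-16768, line `Sketch`, registered stub `stub_certOfCoreFrom`)

The packaging half of the v7/v8 reshape of the physics stub P″ of the line `Sketch`
(`Cruxes/NeckGapDecay/Lines/Sketch.lean`): **`CertOfCoreFrom : NearIdInjOpen → BilinPullbackNearIdConst →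
MovingShellCutoff → CertOfCore`**, where `CertOfCore` says that for any spacetime, region, `C⁴` final-state
decomposition `d`, hole `i` with `100 Mᵢ ≤ R₀`, continuous wall `W` and threshold `T₀`, a gap CORE certificate
(`GapCoreCert`: a chart `Ψ'` of the annular late tube beyond a receding seam sphere inside the input chart's certified
zone, matched to the input chart `Ψᵢ` to third order across the seam collar, `C²`-certified beyond the seam out to the
wall, far annulus separated from `Ψᵢ`'s inner image) yields a gap ANALYTIC certificate (`GapAnalyticCert`: ONE smooth
open embedding of the whole late sub-wall tube, equal to `Ψᵢ` inside `R₁ + 1`, `C²`-certified out to the wall) for the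
same `T₀`, `W`.

PROOF.  The belt chart `Ψg` with (G1), (G2) and its two local formulas is `Glue.exists_beltChart`
(`…GlueBelt.lean`).  (G3): split the slab `{t = τ, r ≤ W}` by the rest norm `s`: below `ϱ + 3/2` the glued chart IS
`Ψᵢ` (germs), so the input certificate out to `ϱ + 6` bounds it; beyond `ϱ + 5/2` it is `Ψ'` (germs), bounded by the
core certificate (C3); on the seam shell `[ϱ + 3/2, ϱ + 5/2]` the zone-2 estimate `Glue.norm_iteratedFDeriv_regauge_sub_le`
(splitting `S^*(Ψᵢ^*g − g_B) + (S^*η − η) + S^*(g_B − η) − (g_B − η)`; the input certificate at `S z`, stub W2, and the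
`1/r` decay of the boosted Kerr–Schild perturbation at the RECEDING seam `ϱ → ∞`) gives `≤ (1025 + 64 G) ε` eventually,
for every `ε > 0`; the three pieces are added (`Glue.supCkENorm_union_le`).

References: DHRT arXiv:2104.08222, §1 (deviation norms on slabs); O'Neill 1983, Ch. 3 (pull-backs); Kerr–Schild 1965,
§3.  Definitions introduced: the registered `Prop`s `GapAnalyticCert`, `GapCoreCert` (predicates, `[folklore]`),
`CertOfCore`, `CertOfCoreFrom` (Summit-level, untagged), verbatim the skeleton's v8 text.
-/

noncomputable section

open scoped Manifold ContDiff Topology ENNReal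
open Filter Set Function Topology Literature.Geometry.Lorentzian

namespace Summit.FinalStateConjecture.FinalStateConjecture.Theorems.NeckGapDecay.ConnectionLevelCones.CertOfCoreStub

set_option linter.dupNamespace false
-- instance search through nested operator types `E4 →L[ℝ] E4 →L[ℝ] ℝ`
set_option maxSynthPendingDepth 3

open Literature.Uncategorized
open Summit.FinalStateConjecture.FinalStateConjecture.Theorems.NeckGapDecay.ConnectionLevelCones.Glue

/-! ## The registered statements (verbatim the skeleton's `Lines/Sketch.lean` v8 definitions) -/

/-- **Gap analytic certificate of hole `i` for the wall `W` from threshold `T₀`** (the packaged output P″ of the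
`NeckGapDecay` line `Sketch`): `R₀ ≤ R₁`, `max τ₀ T₀ ≤ τ₁`, (G1) smooth open embedding of the late sub-wall tube
`{τ₁ < t, r < W(x⁰)+1}` into `d.charted`, (G2) `= Ψᵢ` inside `R₁+1`, (G3) `C²` deviation from boosted Kerrᵢ `→ 0` on
the slabs `{t = τ, r ≤ W(x⁰)}`.  DHRT arXiv:2104.08222, §1 (deviation norms on slabs). [folklore] -/
def GapAnalyticCert (𝓢 : Spacetime.{0} 4) (O : Set 𝓢.carrier) (d : FinalStateDecomposition 𝓢 O 4) (R₀ : ℝ)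
    (i : Fin d.N) (T₀ : ℝ) (W : ℝ → ℝ) : Prop :=
  ∃ (R₁ τ₁ : ℝ) (Ψg : (d.background i).domain → 𝓢.carrier),
    let B := d.background i; let t := B.time; let r := B.radius;
    R₀ ≤ R₁ ∧ max d.τ₀ T₀ ≤ τ₁ ∧
    (let U : Set B.domain := {x | τ₁ < t x.1 ∧ r x.1 < W (x.1 0) + 1};
      ContMDiffOn 𝓘(ℝ, E4) (𝓡 4) ∞ Ψg U ∧ Topology.IsOpenEmbedding (U.restrict Ψg) ∧ Ψg '' U ⊆ d.charted) ∧
    (∀ x : B.domain, r x.1 ≤ R₁ + 1 → Ψg x = d.chart i x) ∧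
    Tendsto (fun τ ↦ supCkENorm (Subtype.val '' {x : B.domain | t x.1 = τ ∧ r x.1 ≤ W (x.1 0)}) 2
      (𝓢.deviationExtend B Ψg)) atTop (𝓝 0)

/-- **Gap CORE certificate of hole `i` for the wall `W` from threshold `T₀`** (the physics stub P-core's output):
as `GapAnalyticCert`, but the chart `Ψ'` is asked for only on the ANNULAR late tube beyond a receding seam sphere
`{s = ϱ(t) + 1}` (rest-frame Euclidean norm `s = ‖(Λᵢ⁻¹(x − cᵢ))⃗‖`, rest time `t`; `ϱ → ∞` smooth and slow,
`ϱ ≥ R₁ + Mᵢ + 1`, inside the input chart's own `C²`-certified zone: `truncDeviationCk (ϱ τ + 6) τ → 0`), and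
instead of AGREEING with the input chart `Ψᵢ` inside `R₁+1` it is MATCHED to it to third order across the seam collar
`{ϱ(t)+1 < s < ϱ(t)+4}`: `Ψ' = Ψᵢ ∘ T` there, for a smooth self-map `T` of `E4` whose `C³`-distance to the identity on
the collar slabs tends to `0`; plus (C1) smooth open embedding of the annular tube into `d.charted`, (C3) the `C²`
certificate beyond `s ≥ ϱ + 2` out to the wall, (C4) separation of the far annulus `{s ≥ ϱ + 3}` from the input
chart's image of the inner ball `{s ≤ ϱ + 11/4}`.  DHRT arXiv:2104.08222, §1. [folklore] -/
def GapCoreCert (𝓢 : Spacetime.{0} 4) (O : Set 𝓢.carrier) (d : FinalStateDecomposition 𝓢 O 4) (R₀ : ℝ)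
    (i : Fin d.N) (T₀ : ℝ) (W : ℝ → ℝ) : Prop :=
  ∃ (R₁ τ₁ : ℝ) (ϱ : ℝ → ℝ) (Ψ' : (d.background i).domain → 𝓢.carrier) (T : E4 → E4),
    let B := d.background i; let t := B.time; let r := B.radius;
    let s : E4 → ℝ := fun y ↦ E4.spatialNorm (poincareInv (d.motion i).1 (d.motion i).2 y);
    R₀ ≤ R₁ ∧ max d.τ₀ T₀ ≤ τ₁ ∧
    (ContDiff ℝ ∞ ϱ ∧ (∀ u, |deriv ϱ u| ≤ 1) ∧ (∀ u, |iteratedDeriv 2 ϱ u| ≤ 1) ∧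
      (∀ u, |iteratedDeriv 3 ϱ u| ≤ 1) ∧ (∀ u, R₁ + d.mass i + 1 ≤ ϱ u) ∧ Tendsto ϱ atTop atTop ∧
      Tendsto (fun τ ↦ 𝓢.truncDeviationCk B (d.chart i) 2 (ϱ τ + 6) τ) atTop (𝓝 0)) ∧
    (let A : Set B.domain := {x | τ₁ < t x.1 ∧ ϱ (t x.1) + 1 < s x.1 ∧ r x.1 < W (x.1 0) + 1};
      ContMDiffOn 𝓘(ℝ, E4) (𝓡 4) ∞ Ψ' A ∧ Topology.IsOpenEmbedding (A.restrict Ψ') ∧ Ψ' '' A ⊆ d.charted) ∧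
    (ContDiff ℝ ∞ T ∧
      (∀ x : B.domain, τ₁ < t x.1 → ϱ (t x.1) + 1 < s x.1 → s x.1 < ϱ (t x.1) + 4 →
        ∃ hx : T x.1 ∈ B.domain, Ψ' x = d.chart i ⟨T x.1, hx⟩) ∧
      Tendsto (fun τ ↦ supCkENorm (Subtype.val '' {x : B.domain | t x.1 = τ ∧ ϱ τ + 1 ≤ s x.1 ∧ s x.1 ≤ ϱ τ + 4}) 3
        (fun y ↦ T y - y)) atTop (𝓝 0)) ∧
    Tendsto (fun τ ↦ supCkENorm (Subtype.val '' {x : B.domain | t x.1 = τ ∧ ϱ τ + 2 ≤ s x.1 ∧ r x.1 ≤ W (x.1 0)}) 2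
      (𝓢.deviationExtend B Ψ')) atTop (𝓝 0) ∧
    (∀ x y : B.domain, τ₁ < t x.1 → ϱ (t x.1) + 3 ≤ s x.1 → r x.1 < W (x.1 0) + 1 →
      τ₁ - 1 < t y.1 → s y.1 ≤ ϱ (t y.1) + 11 / 4 → Ψ' x ≠ d.chart i y)

/-- **P-glue — the certificate from the core** (packaging of the `NeckGapDecay` line `Sketch`): for any spacetime,
region, `C⁴` decomposition `d`, hole `i` with `100 Mᵢ ≤ R₀`, continuous wall `W` and threshold `T₀`,
`GapCoreCert ⇒ GapAnalyticCert` (same `T₀`, `W`): glue `Ψᵢ` (inside the seam) to `Ψ'` (beyond it) along the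
near-identity interpolation `Ψᵢ ∘ (id + χ·(T − id))`.  Summit-level (it is stated through the predicates `GapCoreCert` /
`GapAnalyticCert` declared in this file), hence declared here and not under `Literature/`; the registered statement of the
line skeleton, verbatim. -/
def CertOfCore : Prop :=
  ∀ (𝓢 : Spacetime.{0} 4) (O : Set 𝓢.carrier) (d : FinalStateDecomposition 𝓢 O 4) (R₀ : ℝ) (i : Fin d.N)
    (T₀ : ℝ) (W : ℝ → ℝ), 100 * d.mass i ≤ R₀ → Continuous W →
    GapCoreCert 𝓢 O d R₀ i T₀ W → GapAnalyticCert 𝓢 O d R₀ i T₀ W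

/-- The registered, dependent form of P-glue (stub `stub_certOfCoreFrom` of the line skeleton, verbatim): from the bricks
W1 (`NearIdInjOpen`), W2 (`BilinPullbackNearIdConst`), W3 (`MovingShellCutoff`).  Summit-level like `CertOfCore`. -/
def CertOfCoreFrom : Prop :=
  NearIdInjOpen → BilinPullbackNearIdConst → MovingShellCutoff → CertOfCore

/-! ## The assembly -/

set_option maxHeartbeats 1600000 in
/-- **Registered stub P-glue `stub_certOfCoreFrom`** of the `NeckGapDecay` line `Sketch`: `GapCoreCert ⇒ GapAnalyticCert`
(same threshold and wall), granted the bricks W1, W2, W3: the belt chart of `Glue.exists_beltChart` ((G1), (G2)) has `C²`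
deviation `→ 0` on the sub-wall slabs ((G3), three zones). DHRT arXiv:2104.08222, §1. -/
theorem stub_certOfCoreFrom : CertOfCoreFrom := by
  classical
  intro hW1 hW2 hW3 𝓢 O d R₀ i T₀ W hMR hWc hcore
  obtain ⟨R₁, τ₁, ϱ, Ψ', T, hR₁, hτ₁, ⟨hϱs, hϱ1, hϱ2, hϱ3, hϱR, hϱtop, hcert⟩, ⟨hC1s, hC1e, hC1i⟩,
    ⟨hTs, hC2, hC2t⟩, hC3, hC4⟩ := hcore
  have hτ₀1 : d.τ₀ ≤ τ₁ := (le_max_left _ _).trans hτ₁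
  obtain ⟨χ, G, τa, τs, Ψg, hχs, hχ01, hχ0in, hχ0out, hG0, hχG, hτs1, hτsa, hSdom, hshift, hG1, hG2, hE3, hE2⟩ :=
    exists_beltChart hW1 hW3 𝓢 O d R₀ i W hMR hWc R₁ τ₁ ϱ Ψ' T hR₁ hτ₀1 hϱs hϱ1 hϱ2 hϱ3 hϱR hC1s hC1e hC1i hTs
      hC2 hC2t hC4
  -- notation for hole `i`
  set Λ : lorentzGroup := (d.motion i).1 with hΛ
  set c : E4 := (d.motion i).2 with hc
  set M : ℝ := d.mass i with hM
  set a : ℝ := d.spin i with ha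
  have hM0 : 0 < M := d.mass_pos i
  have haM : |a| ≤ M := d.abs_spin_le_mass i
  set sN : E4 → ℝ := fun y ↦ E4.spatialNorm (poincareInv Λ c y) with hsN
  beta_reduce at hC3 hχ0in hχ0out hshift hE3 hE2 hG1
  obtain ⟨hG1a, hG1e, hG1i⟩ := hG1
  -- continuity bookkeeping
  have hc_t : Continuous fun y : E4 ↦ (d.background i).time y := continuous_time Λ c
  have hc_s : Continuous sN := continuous_spatialNorm Λ c
  have hc_r : Continuous fun y : E4 ↦ (d.background i).radius y :=
    (Kerr.continuous_radius a).comp (continuous_poincareInv Λ c)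
  have hc_ϱt : Continuous fun y : E4 ↦ ϱ ((d.background i).time y) := hϱs.continuous.comp hc_t
  have hc_tv : Continuous fun x : (d.background i).domain ↦ (d.background i).time x.1 :=
    hc_t.comp continuous_subtype_val
  have hc_sv : Continuous fun x : (d.background i).domain ↦ sN x.1 := hc_s.comp continuous_subtype_val
  have hc_rv : Continuous fun x : (d.background i).domain ↦ (d.background i).radius x.1 :=
    hc_r.comp continuous_subtype_val
  have hc_ϱtv : Continuous fun x : (d.background i).domain ↦ ϱ ((d.background i).time x.1) :=
    hc_ϱt.comp continuous_subtype_val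
  have hc_Wv : Continuous fun x : (d.background i).domain ↦ W (x.1 0) + 1 :=
    (hWc.comp ((PiLp.continuous_apply 2 _ 0).comp continuous_subtype_val)).add continuous_const
  have hϱlip : ∀ u v, |ϱ u - ϱ v| ≤ |u - v| := abs_sub_le_of_deriv hϱs hϱ1
  -- the sets of the construction
  set U : Set (d.background i).domain :=
    {x | τs < (d.background i).time x.1 ∧ (d.background i).radius x.1 < W (x.1 0) + 1} with hU
  set V₁p : Set (d.background i).domain :=
    {x | τs - 1 < (d.background i).time x.1 ∧ sN x.1 < ϱ ((d.background i).time x.1) + 3} with hV₁p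
  set V₂p : Set (d.background i).domain :=
    {x | τs - 1 < (d.background i).time x.1 ∧ ϱ ((d.background i).time x.1) + 2 < sN x.1} with hV₂p
  have hUo : IsOpen U := (isOpen_lt continuous_const hc_tv).inter (isOpen_lt hc_rv hc_Wv)
  have hV₁o : IsOpen V₁p := (isOpen_lt continuous_const hc_tv).inter (isOpen_lt hc_sv (hc_ϱtv.add continuous_const))
  have hV₂o : IsOpen V₂p := (isOpen_lt continuous_const hc_tv).inter (isOpen_lt (hc_ϱtv.add continuous_const) hc_sv)
  -- the input chart and its parametrisation `Ψᵢ ∘ ι⁻¹`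
  have hΨi : ContMDiff 𝓘(ℝ, E4) (𝓡 4) ∞ (d.chart i) := (d.isLateChart i).contMDiff
  have hψ : ∀ (x : (d.background i).domain) (z : E4) (hz : z ∈ ((d.background i).domain : Set E4)),
      (d.chart i ∘ (chartAt E4 x).symm) z = d.chart i ⟨z, hz⟩ := by
    intro x z hz
    show d.chart i ((chartAt E4 x).symm z) = _
    congr 1
    exact Subtype.ext (OpensChart.chartAt_symm_val x hz)
  have hPs : ContDiff ℝ ∞ (fun y ↦ χ y • (T y - y)) := hχs.smul (hTs.sub contDiff_id)
  -- late bounds of the interpolation field at any level `e > 0`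
  have hPbε : ∀ e : ℝ, 0 < e → ∃ τe : ℝ, ∀ x : E4, τe ≤ (d.background i).time x →
      ‖χ x • (T x - x)‖ ≤ e ∧ ∀ j, 1 ≤ j → j ≤ 3 → ‖iteratedFDeriv ℝ j (fun y ↦ χ y • (T y - y)) x‖ ≤ 8 * G * e := by
    intro e he
    obtain ⟨τe, hτe⟩ := exists_forall_norm_iteratedFDeriv_le_of_tendsto hC2t he
    refine ⟨τe, fun x hx ↦ late_field_bounds Λ c hϱs.continuous hχs hχ01 hχ0in hχ0out hG0 hχG hTs he.le
      (fun y hyt hy1 hy4 j hj ↦ ?_) hx⟩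
    have hydom : y ∈ ((d.background i).domain : Set E4) := by
      refine mem_domain_of_lt_spatialNorm Λ c hM0.le a ?_
      have := hϱR (poincareInv Λ c y 0)
      linarith [abs_nonneg a]
    exact hτe (poincareInv Λ c y 0) hyt y ⟨⟨y, hydom⟩, ⟨rfl, hy1, hy4⟩, rfl⟩ j hj
  -- `S` of a late point of the domain is a late domain point
  have hSlate : ∀ x : (d.background i).domain, τs - 1 < (d.background i).time x.1 →
      x.1 + χ x.1 • (T x.1 - x.1) ∈ ((d.background i).domain : Set E4) ∧
      d.τ₀ < (d.background i).time (x.1 + χ x.1 • (T x.1 - x.1)) := by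
    intro x hxt
    refine ⟨hSdom x.1 x.2 (by linarith), ?_⟩
    obtain ⟨h2, -⟩ := hshift x.1 (by linarith)
    linarith [(abs_le.mp h2).1]
  /- ───── (G3) zone 1: below the seam the glued chart is the input chart ───── -/
  have hZ1eq : ∀ x : (d.background i).domain, τs - 1 < (d.background i).time x.1 →
      sN x.1 < ϱ ((d.background i).time x.1) + 3 / 2 → Ψg =ᶠ[𝓝 x] d.chart i := by
    intro x hxt hxs
    have hNo : IsOpen {y : (d.background i).domain | τs - 1 < (d.background i).time y.1 ∧
        sN y.1 < ϱ ((d.background i).time y.1) + 3 / 2} :=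
      (isOpen_lt continuous_const hc_tv).inter (isOpen_lt hc_sv (hc_ϱtv.add continuous_const))
    filter_upwards [hNo.mem_nhds ⟨hxt, hxs⟩] with y hy
    have hχy : χ y.1 = 0 := hχ0in y.1 (le_of_lt hy.2)
    rw [hE3 y hy.1 (by linarith [hy.2]), hχy, zero_smul, add_zero]
    exact hψ y y.1 y.2
  have hZ1le : ∀ τ, τs ≤ τ →
      supCkENorm (Subtype.val '' {x : (d.background i).domain | (d.background i).time x.1 = τ ∧
        (d.background i).radius x.1 ≤ W (x.1 0) ∧ sN x.1 < ϱ τ + 3 / 2}) 2 (𝓢.deviationExtend (d.background i) Ψg) ≤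
      𝓢.truncDeviationCk (d.background i) (d.chart i) 2 (ϱ τ + 6) τ := by
    intro τ hτ
    have hcongr : supCkENorm (Subtype.val '' {x : (d.background i).domain | (d.background i).time x.1 = τ ∧
        (d.background i).radius x.1 ≤ W (x.1 0) ∧ sN x.1 < ϱ τ + 3 / 2}) 2 (𝓢.deviationExtend (d.background i) Ψg) =
        supCkENorm (Subtype.val '' {x : (d.background i).domain | (d.background i).time x.1 = τ ∧
        (d.background i).radius x.1 ≤ W (x.1 0) ∧ sN x.1 < ϱ τ + 3 / 2}) 2
          (𝓢.deviationExtend (d.background i) (d.chart i)) := by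
      refine supCkENorm_congr fun z hz ↦ ?_
      obtain ⟨x, hx, rfl⟩ := hz
      refine deviationExtend_eventuallyEq_of_eventuallyEq 𝓢 (d.background i) (hZ1eq x ?_ ?_)
      · linarith [hx.1]
      · rw [hx.1]; exact hx.2.2
    rw [hcongr]
    show _ ≤ supCkENorm (Subtype.val '' (d.background i).truncTimeSlab (ϱ τ + 6) τ) 2
      (𝓢.deviationExtend (d.background i) (d.chart i))
    apply supCkENorm_mono
    apply image_mono
    intro x hx
    have hrs : (d.background i).radius x.1 ≤ sN x.1 := Kerr.radius_le_spatialNorm a (poincareInv Λ c x.1)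
    exact ⟨hx.1, by linarith [hx.2.2]⟩
  /- ───── (G3) zone 3: beyond the switching sphere the glued chart is `Ψ'` ───── -/
  have hZ3le : ∀ τ, τs ≤ τ →
      supCkENorm (Subtype.val '' {x : (d.background i).domain | (d.background i).time x.1 = τ ∧
        (d.background i).radius x.1 ≤ W (x.1 0) ∧ ϱ τ + 5 / 2 < sN x.1}) 2 (𝓢.deviationExtend (d.background i) Ψg) ≤
      supCkENorm (Subtype.val '' {x : (d.background i).domain | (d.background i).time x.1 = τ ∧
        ϱ τ + 2 ≤ sN x.1 ∧ (d.background i).radius x.1 ≤ W (x.1 0)}) 2 (𝓢.deviationExtend (d.background i) Ψ') := by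
    intro τ hτ
    have hcongr : supCkENorm (Subtype.val '' {x : (d.background i).domain | (d.background i).time x.1 = τ ∧
        (d.background i).radius x.1 ≤ W (x.1 0) ∧ ϱ τ + 5 / 2 < sN x.1}) 2 (𝓢.deviationExtend (d.background i) Ψg) =
        supCkENorm (Subtype.val '' {x : (d.background i).domain | (d.background i).time x.1 = τ ∧
        (d.background i).radius x.1 ≤ W (x.1 0) ∧ ϱ τ + 5 / 2 < sN x.1}) 2 (𝓢.deviationExtend (d.background i) Ψ') := by
      refine supCkENorm_congr fun z hz ↦ ?_
      obtain ⟨x, hx, rfl⟩ := hz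
      refine deviationExtend_eventuallyEq_of_eventuallyEq 𝓢 (d.background i) ?_
      have hxV : x ∈ V₂p := ⟨by linarith [hx.1], by rw [hx.1]; linarith [hx.2.2]⟩
      filter_upwards [hV₂o.mem_nhds hxV] with y hy
      exact hE2 y hy.1 hy.2
    rw [hcongr]
    apply supCkENorm_mono
    apply image_mono
    intro x hx
    exact ⟨hx.1, by linarith [hx.2.2], hx.2.1⟩
  /- ───── (G3) zone 2: the seam shell ───── -/
  -- the extended deviation of the glued chart at points of `U ∩ V₁p`, read through `Ψᵢ ∘ ι⁻¹ ∘ S`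
  have hdevU : ∀ y : (d.background i).domain, y ∈ U → y ∈ V₁p →
      𝓢.deviationExtend (d.background i) Ψg y.1 =
        𝓢.metricInCoords ((d.chart i ∘ (chartAt E4 y).symm) ∘ fun w ↦ w + χ w • (T w - w)) y.1 -
          boostedKerrBilin Λ c M a y.1 := by
    intro y hyU hyV
    have hmd : MDifferentiableAt 𝓘(ℝ, E4) (𝓡 4) Ψg y :=
      ((hG1a y hyU).contMDiffAt (hUo.mem_nhds hyU)).mdifferentiableAt (by simp)
    have h1 := 𝓢.metricInCoords_comp_chartAt_symm_sub_eq_deviation (d.background i) Ψg y y.2 hmd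
    rw [Subtype.coe_eta] at h1
    have h2 : 𝓢.metricInCoords (Ψg ∘ (chartAt E4 y).symm) y.1 =
        𝓢.metricInCoords ((d.chart i ∘ (chartAt E4 y).symm) ∘ fun w ↦ w + χ w • (T w - w)) y.1 := by
      refine 𝓢.metricInCoords_congr_of_eventuallyEq ?_
      have hO : IsOpen (Subtype.val '' V₁p) := (d.background i).domain.2.isOpenMap_subtype_val _ hV₁o
      filter_upwards [hO.mem_nhds ⟨y, hyV, rfl⟩] with w hw
      obtain ⟨y', hy', rfl⟩ := hw
      show Ψg ((chartAt E4 y).symm y'.1) = _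
      rw [show (chartAt E4 y).symm y'.1 = y' from Subtype.ext (OpensChart.chartAt_symm_val y y'.2)]
      exact hE3 y' hy'.1 hy'.2
    rw [𝓢.deviationExtend_coe (d.background i) Ψg y, ← h1, h2]
    rfl
  -- the smallness level keeping `‖DʲP‖ ≤ 1/2` in the zone-2 estimate
  set η : ℝ := 1 / (16 * (G + 1)) with hη
  have hη0 : 0 < η := by positivity
  have hηG : 16 * (G + 1) * η = 1 := by rw [hη]; field_simp
  have h8Gη : 8 * G * η ≤ 1 / 2 := by nlinarith [hG0, hη0.le]
  have hZ2 : Tendsto (fun τ ↦ supCkENorm (Subtype.val '' {x : (d.background i).domain | (d.background i).time x.1 = τ ∧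
      (d.background i).radius x.1 ≤ W (x.1 0) ∧ ϱ τ + 3 / 2 ≤ sN x.1 ∧ sN x.1 ≤ ϱ τ + 5 / 2}) 2
      (𝓢.deviationExtend (d.background i) Ψg)) atTop (𝓝 0) := by
    refine tendsto_zero_of_forall_eventually_le (C := 1025 + 64 * G) (by positivity) fun ε hε ↦ ?_
    -- thresholds for this `ε`
    have hε' : 0 < min ε η := lt_min hε hη0
    obtain ⟨τe, hPe⟩ := hPbε (min ε η) hε'
    obtain ⟨τc, hτc⟩ := exists_forall_norm_iteratedFDeriv_le_of_tendsto
      (S := fun τ ↦ Subtype.val '' (d.background i).truncTimeSlab (ϱ τ + 6) τ) (k := 2)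
      (f := 𝓢.deviationExtend (d.background i) (d.chart i)) hcert hε
    obtain ⟨Rk, hRk0, hRk⟩ := exists_radius_forall_norm_iteratedFDeriv_ksPert_le Λ c M a hε
    obtain ⟨τk, hτk⟩ := Filter.eventually_atTop.1 (hϱtop.eventually_ge_atTop (Rk + M + 2))
    refine ⟨max (max (τs + 1) (τe + 1)) (max (τc + 1) τk), fun τ hτ ↦ ?_⟩
    have hτ1 : τs + 1 ≤ τ := le_trans (le_trans (le_max_left _ _) (le_max_left _ _)) hτ
    have hτ2 : τe + 1 ≤ τ := le_trans (le_trans (le_max_right _ _) (le_max_left _ _)) hτ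
    have hτ3 : τc + 1 ≤ τ := le_trans (le_trans (le_max_left _ _) (le_max_right _ _)) hτ
    have hτ4 : τk ≤ τ := le_trans (le_trans (le_max_right _ _) (le_max_right _ _)) hτ
    have hϱτ : Rk + M + 2 ≤ ϱ τ := hτk τ hτ4
    refine supCkENorm_le_ofReal fun m hm z hz ↦ ?_
    obtain ⟨x, ⟨hxt, hxW, hxs1, hxs2⟩, rfl⟩ := hz
    -- `x` is a late point of `U ∩ V₁p`
    have hxU : x ∈ U := ⟨by linarith, by linarith⟩
    have hxV : x ∈ V₁p := ⟨by linarith, by rw [hxt]; linarith⟩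
    have hxa : τa ≤ (d.background i).time x.1 := by linarith
    obtain ⟨hSx, -⟩ := hSlate x hxV.1
    obtain ⟨hts, hss⟩ := hshift x.1 hxa
    -- (a) the germ identity at `x.1`
    have hgerm : 𝓢.deviationExtend (d.background i) Ψg =ᶠ[𝓝 x.1]
        fun w ↦ 𝓢.metricInCoords ((d.chart i ∘ (chartAt E4 x).symm) ∘ fun w ↦ w + χ w • (T w - w)) w -
          boostedKerrBilin Λ c M a w := by
      have hO : IsOpen (Subtype.val '' (U ∩ V₁p)) := (d.background i).domain.2.isOpenMap_subtype_val _ (hUo.inter hV₁o)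
      filter_upwards [hO.mem_nhds ⟨x, ⟨hxU, hxV⟩, rfl⟩] with w hw
      obtain ⟨y, hy, rfl⟩ := hw
      exact hdevU y hy.1 hy.2
    rw [(hgerm.iteratedFDeriv ℝ m).eq_of_nhds]
    -- (b) the inputs of the zone-2 estimate
    have hPx := hPe x.1 (by linarith)
    have hGε : 0 ≤ 8 * G * min ε η := by positivity
    have hGε1 : 8 * G * min ε η ≤ 1 := by nlinarith [min_le_right ε η]
    -- input certificate at `S x.1`
    have hN₁ : ∀ j, j ≤ 2 → ‖iteratedFDeriv ℝ j (𝓢.deviationExtend (d.background i) (d.chart i))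
        (x.1 + χ x.1 • (T x.1 - x.1))‖ ≤ ε := by
      intro j hj
      refine hτc ((d.background i).time (x.1 + χ x.1 • (T x.1 - x.1))) ?_ _ ⟨⟨_, hSx⟩, ⟨rfl, ?_⟩, rfl⟩ j hj
      · linarith [(abs_le.mp hts).1]
      · have hrs : (d.background i).radius (x.1 + χ x.1 • (T x.1 - x.1)) ≤ sN (x.1 + χ x.1 • (T x.1 - x.1)) :=
          Kerr.radius_le_spatialNorm a _
        have hϱ' := hϱlip ((d.background i).time (x.1 + χ x.1 • (T x.1 - x.1))) ((d.background i).time x.1)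
        have hϱx : ϱ ((d.background i).time x.1) = ϱ τ := by rw [hxt]
        linarith [(abs_le.mp hss).2, (abs_le.mp hϱ').1, (abs_le.mp hts).1, (abs_le.mp hts).2]
    -- Kerr–Schild decay at `S x.1` and at `x.1`
    have hsNr : ∀ w : E4, sN w ≤ Kerr.radius a (poincareInv Λ c w) + |a| :=
      fun w ↦ spatialNorm_poincareInv_le_radius_add_abs Λ c a w
    have hN₃ : ∀ j, j ≤ 2 → ‖iteratedFDeriv ℝ j (ksPert Λ c M a) (x.1 + χ x.1 • (T x.1 - x.1))‖ ≤ ε := by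
      intro j hj
      refine hRk _ ?_ j hj
      have h1 := hsNr (x.1 + χ x.1 • (T x.1 - x.1))
      linarith [(abs_le.mp hss).1]
    have hN₄ : ∀ j, j ≤ 2 → ‖iteratedFDeriv ℝ j (ksPert Λ c M a) x.1‖ ≤ ε := by
      intro j hj
      refine hRk _ ?_ j hj
      have h1 := hsNr x.1
      linarith
    have key := norm_iteratedFDeriv_regauge_sub_le 𝓢 Λ c M a hW2 (d.chart i) hΨi x hPs x.2 hSx hGε hGε1
      hPx.2 hε.le hN₁ hε.le hN₃ hN₄ hm
    refine key.trans ?_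
    have hmin : min ε η ≤ ε := min_le_left _ _
    nlinarith [hG0, hε.le]
  /- ───── (G3): assembling the three zones ───── -/
  have hG3 : Tendsto (fun τ ↦ supCkENorm (Subtype.val '' {x : (d.background i).domain |
      (d.background i).time x.1 = τ ∧ (d.background i).radius x.1 ≤ W (x.1 0)}) 2
      (𝓢.deviationExtend (d.background i) Ψg)) atTop (𝓝 0) := by
    have hup : Tendsto (fun τ ↦ 𝓢.truncDeviationCk (d.background i) (d.chart i) 2 (ϱ τ + 6) τ +
        supCkENorm (Subtype.val '' {x : (d.background i).domain | (d.background i).time x.1 = τ ∧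
          (d.background i).radius x.1 ≤ W (x.1 0) ∧ ϱ τ + 3 / 2 ≤ sN x.1 ∧ sN x.1 ≤ ϱ τ + 5 / 2}) 2
          (𝓢.deviationExtend (d.background i) Ψg) +
        supCkENorm (Subtype.val '' {x : (d.background i).domain | (d.background i).time x.1 = τ ∧
          ϱ τ + 2 ≤ sN x.1 ∧ (d.background i).radius x.1 ≤ W (x.1 0)}) 2 (𝓢.deviationExtend (d.background i) Ψ'))
        atTop (𝓝 0) := by
      simpa using (hcert.add hZ2).add hC3
    refine tendsto_of_tendsto_of_tendsto_of_le_of_le' tendsto_const_nhds hup (Eventually.of_forall fun _ ↦ zero_le) ?_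
    filter_upwards [eventually_ge_atTop τs] with τ hτ
    -- split the slab piece by the rest norm
    have hsub : Subtype.val '' {x : (d.background i).domain | (d.background i).time x.1 = τ ∧
          (d.background i).radius x.1 ≤ W (x.1 0)} ⊆
        (Subtype.val '' {x : (d.background i).domain | (d.background i).time x.1 = τ ∧
          (d.background i).radius x.1 ≤ W (x.1 0) ∧ sN x.1 < ϱ τ + 3 / 2} ∪
        Subtype.val '' {x : (d.background i).domain | (d.background i).time x.1 = τ ∧
          (d.background i).radius x.1 ≤ W (x.1 0) ∧ ϱ τ + 3 / 2 ≤ sN x.1 ∧ sN x.1 ≤ ϱ τ + 5 / 2}) ∪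
        Subtype.val '' {x : (d.background i).domain | (d.background i).time x.1 = τ ∧
          (d.background i).radius x.1 ≤ W (x.1 0) ∧ ϱ τ + 5 / 2 < sN x.1} := by
      rintro _ ⟨x, ⟨h1, h2⟩, rfl⟩
      rcases lt_or_ge (sN x.1) (ϱ τ + 3 / 2) with h | h
      · exact Or.inl (Or.inl ⟨x, ⟨h1, h2, h⟩, rfl⟩)
      rcases le_or_gt (sN x.1) (ϱ τ + 5 / 2) with h' | h'
      · exact Or.inl (Or.inr ⟨x, ⟨h1, h2, h, h'⟩, rfl⟩)
      · exact Or.inr ⟨x, ⟨h1, h2, h'⟩, rfl⟩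
    refine (supCkENorm_mono hsub 2 _).trans ?_
    refine (supCkENorm_union_le _ _ 2 _).trans ?_
    refine (add_le_add (supCkENorm_union_le _ _ 2 _) le_rfl).trans ?_
    exact add_le_add (add_le_add (hZ1le τ hτ) le_rfl) (hZ3le τ hτ)
  -- conclusion
  exact ⟨R₁, τs, Ψg, hR₁, by linarith [le_max_left d.τ₀ T₀], ⟨hG1a, hG1e, hG1i⟩, hG2, hG3⟩


end Summit.FinalStateConjecture.FinalStateConjecture.Theorems.NeckGapDecay.ConnectionLevelCones.CertOfCoreStub

end
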